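import Literature.NumberTheory.NumberFields.CMFieldHasseNorm
import Literature.NumberTheory.Automorphic.Liu2021.Def411WeilCarriers
import Literature.NumberTheory.GelbartRogawski1991.UnitaryDualPairThetaKernelCM
import HarnessLib

/-!
# Crux `HLiu418`, line LD1 (θ-road, organ (L-T⁺) «line transport of a strong meets») — the HASSE STEP: two hermitian lines `⟨a₁⟩`, `⟨a″⟩`
# over the CM field `L` that are locally isometric at every finite place (`locF a₁ = locF a″`) with totally positive ratio are GLOBALLY
# isometric: `a₁ · a″⁻¹ = e · ē` for some `e ∈ L`

Cell hodgecm-mathlib (D-0151), FLOOR 0; crux item `HLiu418` = stmt-HodgeConjecture-24832; half-A line LD1 (`stub_S1_facts` = #73), θ-road (LEAD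
«LD-R3′» PATH Y, 2026-09-02T05:11:42Z), organ (L-T⁺) = the hypothesis `hLT` of ★ `F0LD1ThetaLinePinnedOfBricks.thetaLinePinned₂_of_bricks`
(p849302): «`Meets P λ a″ ιA → (∀ v, locF a₁ v = locF a″ v) → (∀ ρ, 0 < ρ(a₁·a″⁻¹)) → Meets P λ a₁ ιA`».  DEAL (LD1-plan (g0) 05:13:21Z, split):
LD1-p02 (g2) = the KIT `Liu2021/ThetaLiftFromLineSeamRescale` (`MeetsThetaLiftFromLine.rescale`); LA1-p01 (g2) = the assembly
`Theorems/F0LD1LineTransportOfKits` (conclusion `hLT` verbatim), of which THIS file is the kit-independent first brick.  THEOREMS ONLY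
(no `def`, no instance, no notation, no named fact, no `sorry`); `--supports stmt-HodgeConjecture-24832`.  HC_CM is proved only modulo the 7
printed citations (2 remaining: hLiu418 = stmt-HodgeConjecture-24832, h413 = stmt-HodgeConjecture-24833) until rung 0 closes; this file discharges
nothing printed.

This file is the number-theoretic heart of (L-T⁺), independent of the theta kits: the Hasse norm theorem for the CM quadratic extension
`L ∕ L⁺` (★ `IsCMField.exists_eq_mul_complexConj_of_totallyPositive_of_forall_isLocalNorm`, [Omeara1963, §65D Thm. 65:23]; [MilneCM2006, II §9
Lemma 9.14]) applied to `b := a₁ · a″⁻¹`: the local-norm hypotheses at the finite places ARE the equalities of the line classes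
`locF L⁺ (imagUnitSq L) a₁ v = locF L⁺ (imagUnitSq L) a″ v` ([Liu2021, Def. 4.11∕4.12]: `ε_v ∈ L⁺_v^× ∕ Nm L_v^×`, ★ `locF_apply`, ★
`mem_quadraticNormSubgroup_iff`), the archimedean ones are the total positivity.  The assembly then composes ★
`MeetsThetaLiftFromLine.frameTransport` at the scalar isometry `e • 1` with the kit's `rescale` and identifies the composite transport with `ιA`.

* `exists_sq_sub_mul_sq_of_locF_eq` — `locF a₁ v = locF a″ v ⇒ (a₁ · a″⁻¹)_v = x² − δ²y²` in `L⁺_v`;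
* **`exists_eq_mul_complexConj_of_locF_eq_of_totallyPositive`** — `∃ e : L, a₁ · a″⁻¹ = e · ē` (hence `e ≠ 0`: `ne_zero_of_eq_mul_complexConj`).

## References
* [Omeara1963] O. T. O'Meara, *Introduction to Quadratic Forms* (1963), §65D Thm. 65:23 (Hasse norm theorem for quadratic extensions).
* [MilneCM2006] J. S. Milne, *Complex Multiplication* (2006), Ch. II §9, proof of Lemma 9.14 (p. 79).
* [Liu2021] Y. Liu, Camb. J. Math. 9 (2021) = arXiv:2102.11518, Def. 4.11–4.12 (l. 2088–2108); App. D §D.1 Step 1 footnote (l. 5215).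
-/

set_option autoImplicit false
-- the mandated namespace has the single-problem summit's repeated segment (`HodgeConjecture.HodgeConjecture`)
set_option linter.dupNamespace false

noncomputable section

open NumberField IsDedekindDomain
open Literature.NumberTheory.NumberFields Literature.NumberTheory.QuadraticForms
open Literature.NumberTheory.Automorphic.Liu2021.Def411WeilCarriers
open Literature.NumberTheory.GelbartRogawski1991.UnitaryDualPair

namespace Summit.HodgeConjecture.HodgeConjecture.Cruxes.HLiu418.F0LD1LineClassHasse

/-! ## §1 The Hasse step: local isometry of the lines everywhere + total positivity ⇒ global isometry -/

section Hasse

variable (L : Type) [Field L] [NumberField L] [IsCMField L]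

/-- **Equal line classes at `v` ⇒ the ratio is a local norm at `v`**: `locF a₁ v = locF a″ v` in `L⁺_v^× ∕ Nm` means
`(a₁ · a″⁻¹)_v = x² − δ² y²` for some `x, y ∈ L⁺_v` (★ `locF_apply`, Mathlib `QuotientGroup.eq`, ★ `mem_quadraticNormSubgroup_iff`).
[cite: Liu2021, Def. 4.11–4.12 (l. 2088–2108)] [cite: Omeara1963, §65D Thm. 65:23] -/
theorem exists_sq_sub_mul_sq_of_locF_eq (a₁ a'' : (↥(maximalRealSubfield L))ˣ) (v : HeightOneSpectrum (𝓞 ↥(maximalRealSubfield L)))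
    (h : locF (↥(maximalRealSubfield L)) (imagUnitSq L) a₁ v = locF (↥(maximalRealSubfield L)) (imagUnitSq L) a'' v) :
    ∃ x y : v.adicCompletion ↥(maximalRealSubfield L),
      x ^ 2 - algebraMap (↥(maximalRealSubfield L)) _ (imagUnitSq L) * y ^ 2 =
        algebraMap (↥(maximalRealSubfield L)) _ (((a₁ * a''⁻¹ : (↥(maximalRealSubfield L))ˣ) : ↥(maximalRealSubfield L))) := by
  rw [locF_apply, locF_apply] at h
  have hmem := QuotientGroup.eq.1 h.symm
  rw [← map_inv, ← map_mul, mul_comm] at hmem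
  obtain ⟨x, y, hxy⟩ := mem_quadraticNormSubgroup_iff.1 hmem
  exact ⟨x, y, by rw [hxy]; rfl⟩

/-- **THE HASSE STEP of (L-T⁺)**: if the hermitian lines `⟨a₁⟩`, `⟨a″⟩` (`a₁, a″ ∈ (L⁺)^×`) have the same class at every finite place
(`locF a₁ = locF a″` componentwise) and `a₁ · a″⁻¹` is totally positive, then `a₁ · a″⁻¹ = e · ē` for some `e ∈ L` — the Hasse norm theorem for
`L ∕ L⁺ = L⁺(δ)` (★ `IsCMField.exists_eq_mul_complexConj_of_totallyPositive_of_forall_isLocalNorm` at `α := δ = imagUnit L`, `θ := δ²`).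
[cite: Omeara1963, §65D Thm. 65:23] [cite: MilneCM2006, Ch. II §9, proof of Lemma 9.14 (p. 79)] [cite: Liu2021, App. D §D.1 Step 1 footnote (l. 5215)] -/
theorem exists_eq_mul_complexConj_of_locF_eq_of_totallyPositive (a₁ a'' : (↥(maximalRealSubfield L))ˣ)
    (hloc : ∀ v : HeightOneSpectrum (𝓞 ↥(maximalRealSubfield L)),
      locF (↥(maximalRealSubfield L)) (imagUnitSq L) a₁ v = locF (↥(maximalRealSubfield L)) (imagUnitSq L) a'' v)
    (hpos : ∀ ρ : ↥(maximalRealSubfield L) →+* ℝ, 0 < ρ ((a₁ : ↥(maximalRealSubfield L)) * ((a'' : ↥(maximalRealSubfield L)))⁻¹)) :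
    ∃ e : L, algebraMap (↥(maximalRealSubfield L)) L ((a₁ : ↥(maximalRealSubfield L)) * ((a'' : ↥(maximalRealSubfield L)))⁻¹) =
      e * IsCMField.complexConj L e := by
  have hsq : imagUnit L ^ 2 = algebraMap (↥(maximalRealSubfield L)) L (imagUnitSq L) := by rw [sq, imagUnit_mul_self]
  have hcoe : (((a₁ * a''⁻¹ : (↥(maximalRealSubfield L))ˣ) : ↥(maximalRealSubfield L))) =
      (a₁ : ↥(maximalRealSubfield L)) * ((a'' : ↥(maximalRealSubfield L)))⁻¹ := by
    rw [Units.val_mul, Units.val_inv_eq_inv_val]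
  refine IsCMField.exists_eq_mul_complexConj_of_totallyPositive_of_forall_isLocalNorm (complexConj_imagUnit L) (imagUnit_ne_zero L) hsq hpos
    fun v => ?_
  obtain ⟨x, y, hxy⟩ := exists_sq_sub_mul_sq_of_locF_eq L a₁ a'' v (hloc v)
  exact ⟨x, y, by rw [hxy, hcoe]⟩

/-- the isometry scalar is non-zero: `e · ē = a₁ · a″⁻¹ ≠ 0 ⇒ e ≠ 0`. [folklore] -/
theorem ne_zero_of_eq_mul_complexConj {b : ↥(maximalRealSubfield L)} (hb : b ≠ 0) {e : L}
    (he : algebraMap (↥(maximalRealSubfield L)) L b = e * IsCMField.complexConj L e) : e ≠ 0 := by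
  rintro rfl
  rw [zero_mul, map_eq_zero_iff _ (algebraMap (↥(maximalRealSubfield L)) L).injective] at he
  exact hb he

end Hasse

end Summit.HodgeConjecture.HodgeConjecture.Cruxes.HLiu418.F0LD1LineClassHasse

end
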